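import Mathlib

/-!
# Sketch — first lemmas of the two crux ideas for `PureTranscendentalFrames`
(stmt-ResolutionOfSingularities-18874, route DefectlessFrames).

Card A `completion-shadow-swap`: purity is decided in the COMPLETION — the "dense" terminal
configuration: if the last coordinate `w` is a limit of elements of the sub-frame field `K₁`
then disjunct D2 of the crux holds verbatim (continuity of polynomial evaluation; no rank
hypothesis needed).

Card B `perfect-hull-frobenius-swap`: the Frobenius moves on a frame are AXIS-EXACT — replacing
the sub-frame coordinate `x_j` by `w^(p^m) - x_j` (resp. `x_j + ψ·w^(p^m)`) changes the axis
polynomial only modulo `(X - w̄)^(p^m)`, so for `p^m > s` the axis order `s` is untouched.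

Nothing here is proved (sorries); the statements only have to elaborate.
-/

namespace Summit.ResolutionOfSingularities.ResolutionOfSingularities.Cruxes.PureTranscendentalFrames.Sketch

open Polynomial

/-- **Card A, first lemma (dense sub-frame ⇒ D2).** If `w` is transcendental over the
intermediate field `K₁` and lies in the closure of `K₁` for the valuation topology of `O`
(every non-zero value is undercut by some `w - a`, `a ∈ K₁`), then for every non-zero
`q ∈ K₁[X]` some `a ∈ K₁` has `v(q(w) - q(a)) < v(q(w))` — the second disjunct of
`PureTranscendentalFrames`, verbatim. (Continuity of `a ↦ q(a)` at `w` and `q(w) ≠ 0`.) -/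
theorem d2_of_mem_closure {k K : Type} [Field k] [Field K] [Algebra k K]
    (O : ValuationSubring K) (K₁ : IntermediateField k K) (w : K)
    (hw : Transcendental K₁ w)
    (hdense : ∀ γ : ValuationSubring.ValueGroup O, γ ≠ 0 →
      ∃ a : K₁, O.valuation (w - algebraMap K₁ K a) < γ) :
    ∀ q : Polynomial K₁, q ≠ 0 →
      ∃ a : K₁, O.valuation (Polynomial.aeval w q - algebraMap K₁ K (Polynomial.eval a q)) <
        O.valuation (Polynomial.aeval w q) := by
  sorry

/-- **Card A, companion (far sub-frame ⇒ D1 with `h = 0`).** If no element of `K₁` is closer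
to `w` than `0` is — e.g. because `v(w)` is not the value of any element of `K₁`, or the
residue of `w/d` is not a residue of `K₁` — then the first disjunct holds with `h = 0`. -/
theorem d1_of_forall_le {k K : Type} [Field k] [Field K] [Algebra k K]
    (O : ValuationSubring K) (K₁ : IntermediateField k K) (w : K)
    (hfar : ∀ a ∈ K₁, O.valuation w ≤ O.valuation (w - a)) :
    ∃ h ∈ K₁, ∀ a ∈ K₁, O.valuation (w - h) ≤ O.valuation (w - a) :=
  ⟨0, K₁.zero_mem, fun a ha => by simpa using hfar a ha⟩

/-- The residual axis map of the crux at the level of the residue field `κ`: substitute the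
residues `c i` of the first `n` frame coordinates and keep the last variable. -/
noncomputable def ax {κ : Type} [Field κ] (n : ℕ) (c : Fin n → κ)
    (G : MvPolynomial (Fin (n + 1)) κ) : Polynomial κ :=
  MvPolynomial.eval₂ Polynomial.C (Fin.snoc (fun i => Polynomial.C (c i)) Polynomial.X) G

/-- The Frobenius swap of the `j`-th sub-frame coordinate against the last one:
`X_j ↦ X_last ^ (p^m) - X_j`, all other variables fixed (so that
`G'' (.., w^(p^m) - x_j, .., w) = G (.., x_j, .., w)`). -/
noncomputable def frobSwap {κ : Type} [Field κ] (n p m : ℕ) (j : Fin n) :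
    Fin (n + 1) → MvPolynomial (Fin (n + 1)) κ :=
  fun i => if i = Fin.castSucc j then
    MvPolynomial.X (Fin.last n) ^ (p ^ m) - MvPolynomial.X (Fin.castSucc j) else MvPolynomial.X i

/-- **Card B, first lemma (Frobenius swaps are axis-exact).** In characteristic `p`, the axis
polynomial of the swapped frame (`x''_j = w^(p^m) - x_j`, residue `w̄^(p^m) - c j`) differs
from the old one by a multiple of `(X - w̄)^(p^m)`: the `j`-th argument changes from `C (c j)`
to `X^(p^m) - C (w̄^(p^m) - c j) = C (c j) + (X - C w̄)^(p^m)`. -/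
theorem ax_frobSwap_sub_dvd (p : ℕ) [Fact p.Prime] {κ : Type} [Field κ] [CharP κ p]
    (n m : ℕ) (c : Fin n → κ) (wbar : κ) (G : MvPolynomial (Fin (n + 1)) κ) (j : Fin n) :
    (Polynomial.X - Polynomial.C wbar) ^ (p ^ m) ∣
      ax n (Function.update c j (wbar ^ (p ^ m) - c j)) (MvPolynomial.bind₁ (frobSwap n p m j) G)
        - ax n c G := by
  sorry

/-- **Card B, corollary (axis order untouched when `p^m > s`).** -/
theorem rootMultiplicity_ax_frobSwap (p : ℕ) [Fact p.Prime] {κ : Type} [Field κ] [CharP κ p]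
    (n m : ℕ) (c : Fin n → κ) (wbar : κ) (G : MvPolynomial (Fin (n + 1)) κ) (j : Fin n)
    (hG : ax n c G ≠ 0) (hs : (ax n c G).rootMultiplicity wbar < p ^ m) :
    ax n (Function.update c j (wbar ^ (p ^ m) - c j)) (MvPolynomial.bind₁ (frobSwap n p m j) G)
        ≠ 0 ∧
      (ax n (Function.update c j (wbar ^ (p ^ m) - c j))
          (MvPolynomial.bind₁ (frobSwap n p m j) G)).rootMultiplicity wbar =
        (ax n c G).rootMultiplicity wbar := by
  sorry

/-- **Card B, the same congruence for Frobenius TWISTS** `x_j ↦ x_j + ψ̄ · w^(p^m)` (`ψ̄` the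
residue of a polynomial in the other sub-frame coordinates — a residual constant). -/
theorem ax_frobTwist_sub_dvd (p : ℕ) [Fact p.Prime] {κ : Type} [Field κ] [CharP κ p]
    (n m : ℕ) (c : Fin n → κ) (wbar ψ : κ) (G : MvPolynomial (Fin (n + 1)) κ) (j : Fin n) :
    let twist : Fin (n + 1) → MvPolynomial (Fin (n + 1)) κ := fun i =>
      if i = Fin.castSucc j then
        MvPolynomial.X (Fin.castSucc j) - MvPolynomial.C ψ * MvPolynomial.X (Fin.last n) ^ (p ^ m)
      else MvPolynomial.X i
    (Polynomial.X - Polynomial.C wbar) ^ (p ^ m) ∣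
      ax n (Function.update c j (c j + ψ * wbar ^ (p ^ m))) (MvPolynomial.bind₁ twist G)
        - ax n c G := by
  sorry

end Summit.ResolutionOfSingularities.ResolutionOfSingularities.Cruxes.PureTranscendentalFrames.Sketch
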